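import Summits.QuantumFields.BalabanUV.Beta.GAN24.InsertionWordVolumeLimit

/-!
# `BalabanUV.Beta.GAN24.InsertionWordTwoPointDecay` — binder row G-an2-4 ∕ (CONV-C), routes C-R6° («VALUES») × R7 («TWO CURRENCIES»), PART 198:
# THE LEGS OF THE ONE-LOOP CONTRACTION, DECAY HALF — TWO-POINT DECAY ABOUT THE INSERTION BOND OF THE SINGLE-INSERTION WORD
# `X_{i,k} = L^{dk}Q_k(𝒢^{(k)}P(V_i)^{(k)}𝒢^{(k)})Q_kᴴ` FOR A LOCALISED BACKGROUND `V_i`, VOLUME-FREE AND LEVEL-FREE: (L-UD) `‖X_{i,k}(x,y)‖ ≤ B·e^{−κ(distK(x,i) + distK(y,i))}`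
# for every BOUNDED background supported near the block of `i` (no smoothness), and (L-SR) `‖(X_{i,k+1} − X_{i,k})(x,y)‖ ≤ B′(√(L⁻¹))^k e^{−κ(…)}` for every
# LIPSCHITZ such background — the two leg envelopes PART 197's `conv_oneLoop_loopCov_moving_of_rate` displays (census V196 ∕ V201‴ (L-UD), (L-SR)).
# PART 159 gives (UD)+(SR) of every word in the PAIR distance `distK(x,y)`; the legs need decay in BOTH arguments about the ROOT `i`.  The mechanism is a
# two-weight Combes–Thomas dictionary: `⟨u, 𝒢·(P_i𝒢)·v⟩ = ⟨u, 𝒢w⟩`, `w = (P_i𝒢)v` supported where `P_i`'s rows live (near `i`); the left pairing is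
# `e^{κρ_i}`-conjugated (`u` far, `w` near), the right one `e^{−κρ_i}`-conjugated (`w` near, `v` far) — NE2's conjugation-defect and weighted (H-bd) lemmas are
# stated for ANY `1∕n_k`-Lipschitz weight, so `−ρ_i` is as good as `ρ_i` (unit b2b-balaban-gan24-p3, gen 62; v1)

NOT IN PRINT; OUR PROOF ([folklore] bookkeeping BY NAME over NE2's `CTAveragedTowerDecay.pairing_le_of_opNorm_conjMat` ∕ `avgTow_apply_eq_pairing` ∕ `nsq_star_Atow_le` ∕
`opNorm_conjMat_inv_le_of_wCoercive` ∕ `conjMat_mul_same`, `CTVectorPropagator.conjDefect_DeltaA`, `CTConjugatedHbd.opNorm_conjMat_firstOrder_le` ∕ `wCoercive_calDa_of_conjDefect`,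
`CTConjDefectDischarge.conjDefect_calDalev_rho`, `CTKingTowerWeights` (`abs_rho_fineStep_le`, `abs_rhoSite_fineStep_le`, `abs_rhoSite_sub_le_one_of_blockOf_eq`), PART 126
(`conjMat_sub_const`, `distK_sub_three_le_rho_of_near`, `tdist_blockOf_le_one_of_Atow_QBlev_ne_zero`), PART 124 (`exists_admissible_rate`), PART 151 (`Pmodel_mul_apply`), PART 122
(`towerLimitRate_word`), `DecayRateInterpolation.decayRate_of_towerLimitRate`; [Balaban1987RG1] (1.20)–(1.22) p. 264 LOCATE the one-loop shape; nothing printed is a hypothesis).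
HONEST FRAMING (cell contract, verbatim): «discharging `BetaPertH` makes Bałaban's UV stability UNCONDITIONAL — a real constructive-QFT result; it is NOT the
continuum limit and NOT the Clay problem.»  HONEST DEPENDENCY (verbatim): «continuum YM on T⁴ ⇐ BetaPertH ∧ nine spine estimates (0/9 proved); BetaPertH ⇐
(D1) ∧ (D4) ∧ CAP+tail; G-an2-4 gates asym, D1 and NE2/3/4.»

WHAT THIS FILE PROVES (0 sorry, 0 `def`; `𝒢_k = calGlev k = (calDalev k)⁻¹`, `P(V)_k = Pmodel V k`, `ρ_{k,i} = rho k i` the canonical weight centred at the unit bond `i`,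
`c_{±}(X) = conjMat κ (±ρ_{k,i}) (±ρ_{k,i}) X`):
* §1 (GENERIC, any finite index type, any weight `ρ`, `κ ≥ 0`) `rho_le_of_mulVec_ne_zero` (the image of a kernel whose rows live where `ρ ≤ c₀` lives there);
  **`sqrt_nsq_mulVec_le_of_rows`** (`‖Yv‖ ≤ ‖c₋(Y)‖·e^{−κ(R − c₀)}·‖v‖` for `v` supported where `ρ ≥ R`); **`twoPoint_pairing_le`**
  (`|⟨u, GYv⟩| ≤ ‖c₊(G)‖‖c₋(Y)‖e^{−κ(R_u − c₀)}e^{−κ(R_v − c₀)}‖u‖‖v‖`); **`twoPoint_avgTow_le`** (any averagings `‖A_j‖² ≤ r⁻¹`, any «distance»: the averaged kernel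
  `r^k·Atow_k(GY)Atow_kᴴ` decays in `dist(x,i) + dist(y,i)` about any centre `i` whose weight is `≥ dist(x,i) − c` on the block test vector of `x`).
* §2 (Bałaban's tower, the weight `−ρ_{k,i}`) **`conjDefect_calDalev_negRho`**, **`opNorm_conjMat_firstOrder_negRho_le`** (NE2's `hJ` and conjugated (H-bd) at `−ρ_{k,i}` — the
  weight lemmas only see `|ρ(x + e_ν) − ρ(x)|`), `rho_le_of_Pmodel_mul_ne_zero` (the rows of `P(V)_k·G` live on the support of `V^{(k)}`).
* §3 **`exists_twoPoint_insertion`** — (L-UD): `∃ κ > 0, B ≥ 0` from `(d, a, α, c₀)` such that on EVERY torus, for EVERY unit bond `i` and EVERY background with `‖V‖ ≤ α`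
  supported where `ρ_{k,i} ≤ c₀` (all levels): `‖X_{i,k}(x,y)‖ ≤ B·e^{−κ(distK(x,i) + distK(y,i))}` for all `k, x, y`.  NO Lipschitz hypothesis.
* §4 **`exists_twoPoint_insertion_rate`** — (L-UD)+(L-SR) (`L ≥ 2`, `d ≥ 1`): `∃ κ > 0, B, B′ ≥ 0` from `(d, L, a, α, β, c₀)` such that for EVERY torus, bond `i` and
  `LipschitzBackground V α β` supported where `ρ_{k,i} ≤ c₀`: the level envelope above AND `‖(X_{i,k+1} − X_{i,k})(x,y)‖ ≤ B′·(√(L⁻¹))^k·e^{−κ(distK(x,i) + distK(y,i))}`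
  (`decayRate_of_towerLimitRate` on PART 122's tower rate with the two-point «distance» `(x,y) ↦ distK(x,i) + distK(y,i)`).
WHAT IT DOES NOT DO: EL₃ of the legs and the `ℤ^{d}` END (PART 199 ∕ 200); the INDICATOR background `1_{block i}` (bounded and localised — §3 applies — but NOT Lipschitz at its own
spacing, so §4 does not: its step envelope is the located analysis item of census V201‴); the identification of Bałaban's `Π⁰` with these words (row an1's dictionary).
SUPPLIER work; NEVER «G-an2-4 closed»; NOT (CONV-C), NOT D1, NOT `BetaPertH`, NOT continuum, NOT Clay.  Records: `HOME/b2b-balaban-gan24-p3/gen62/README.md`.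
-/

noncomputable section

open scoped BigOperators ComplexConjugate Matrix Matrix.Norms.L2Operator
open Filter Topology

namespace Summit.QuantumFields.BalabanUV.Beta.GAN24.InsertionWordTwoPointDecay

open Literature.MathematicalPhysics.QuantumFieldTheory.Balaban1983to89
open Literature.MathematicalPhysics.QuantumFieldTheory.Balaban1983to89.B5Prop11Plancherel (Tor fine Cst Cst_nonneg)
open Literature.MathematicalPhysics.QuantumFieldTheory.Balaban1983to89.B5Prop11Lower (nsq nsq_nonneg star_dotProduct_self)
open Literature.MathematicalPhysics.QuantumFieldTheory.Balaban1983to89.B5G183RateUnitTower (lev)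
open Summit.QuantumFields.BalabanUV.T4Continuum
open Summit.QuantumFields.BalabanUV.T4Continuum.CovariantAveragingTower (Atow avgTow)
open Summit.QuantumFields.BalabanUV.T4Continuum.BalabanAveragedTowerUnit (idx QBlev calGlev one_le_lev' opNorm_QBlev_sq_le)
open Summit.QuantumFields.BalabanUV.T4Continuum.BalabanAveragingPairing (freeTowerLaws_balaban)
open Summit.QuantumFields.BalabanUV.T4Continuum.KingPairingPlantedLaw (calDalev calDalev_inv CJ CJ_nonneg)
open Summit.QuantumFields.BalabanUV.T4Continuum.FirstOrderBackgroundModel (LipschitzBackground Pmodel C2model perturbationLaws_firstOrder)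
open Summit.QuantumFields.BalabanUV.T4Continuum.CTWeightedCoercivity (conjMat conjMat_apply WCoercive ConjDefect)
open Summit.QuantumFields.BalabanUV.T4Continuum.CTAveragedTowerDecay (pairing_le_of_opNorm_conjMat avgTow_apply_eq_pairing nsq_star_Atow_le
  opNorm_conjMat_inv_le_of_wCoercive conjMat_mul_same)
open Summit.QuantumFields.BalabanUV.T4Continuum.CTKingTowerWeights (rho rhoSite distK abs_rho_fineStep_le abs_rhoSite_fineStep_le abs_rhoSite_sub_le_one_of_blockOf_eq)
open Literature.MathematicalPhysics.QuantumFieldTheory.Balaban1983to89.B5DeltaA169 (calDa_eq_DeltaA)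
open Summit.QuantumFields.BalabanUV.T4Continuum.CTConjugatedHbd (G2 G2_nonneg wCoercive_calDa_of_conjDefect opNorm_conjMat_firstOrder_le)
open Summit.QuantumFields.BalabanUV.T4Continuum.CTConjDefectDischarge (conjDefect_calDalev_rho max_JA_lt_gamD)
open Summit.QuantumFields.BalabanUV.T4Continuum.CTVectorPropagator (JA conjDefect_DeltaA)
open Summit.QuantumFields.BalabanUV.T4Continuum.DirichletRegionTower (gamD)
open Summit.QuantumFields.BalabanUV.T4Continuum.DecayRateInterpolation (EntryDecay TwoLevelDecayRate decayRate_of_towerLimitRate)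
open Summit.QuantumFields.BalabanUV.Beta.GAN24.UnitLatticeDecayAlgebra (distK_nonneg)
open Summit.QuantumFields.BalabanUV.Beta.GAN24.InsertionChainDecay (exists_admissible_rate)
open Summit.QuantumFields.BalabanUV.Beta.GAN24.InsertionChainDecayBalaban (conjMat_sub_const distK_sub_three_le_rho_of_near tdist_blockOf_le_one_of_Atow_QBlev_ne_zero)
open Summit.QuantumFields.BalabanUV.Beta.GAN24.InsertionChainLawWords (towerLimitRate_word)
open Summit.QuantumFields.BalabanUV.Beta.GAN24.PerturbedPropagatorVolumeLimit (Pmodel_mul_apply)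

/-! ## §1 Generic: the two-weight Combes–Thomas dictionary -/

section Generic

variable {ι : Type*} [Fintype ι] [DecidableEq ι]

omit [DecidableEq ι] in
/-- **the image of a kernel whose rows live where `ρ ≤ c₀` lives there**: `(Yv)(e) ≠ 0 ⟹ ρ e ≤ c₀`. [folklore] -/
theorem rho_le_of_mulVec_ne_zero {Y : Matrix ι ι ℂ} {ρ : ι → ℝ} {c₀ : ℝ} (hY : ∀ e e', Y e e' ≠ 0 → ρ e ≤ c₀) (v : ι → ℂ) (e : ι)
    (he : (Y *ᵥ v) e ≠ 0) : ρ e ≤ c₀ := by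
  by_contra hc
  refine he ?_
  show ∑ e', Y e e' * v e' = 0
  exact Finset.sum_eq_zero fun e' _ => by rw [show Y e e' = 0 from not_not.mp fun h => hc (hY e e' h), zero_mul]

/-- **`sqrt_nsq_mulVec_le_of_rows` — THE NEAR-SUPPORTED IMAGE OF A FAR VECTOR** (`κ ≥ 0`): if the rows of `Y` live where `ρ ≤ c₀`, `‖conjMat κ (−ρ) (−ρ) Y‖ ≤ K` and `v` is supported
where `ρ ≥ R`, then `√nsq(Yv) ≤ K·e^{−κ(R − c₀)}·√nsq v` — `nsq(Yv) = ⟨Yv, Yv⟩` is a pairing of the near vector `Yv` against the far `v`, which the weight `R − ρ` (`≤ 0` on `v`, `≥ R − c₀`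
on `Yv`) controls through `pairing_le_of_opNorm_conjMat`; `conjMat κ (R − ρ) (R − ρ) = conjMat κ (−ρ) (−ρ)` by shift invariance. [folklore] -/
theorem sqrt_nsq_mulVec_le_of_rows {Y : Matrix ι ι ℂ} {κ : ℝ} (hκ : 0 ≤ κ) {ρ : ι → ℝ} {K R c₀ : ℝ}
    (hK : ‖conjMat κ (fun e => -ρ e) (fun e => -ρ e) Y‖ ≤ K) (hY : ∀ e e', Y e e' ≠ 0 → ρ e ≤ c₀)
    {v : ι → ℂ} (hv : ∀ e, v e ≠ 0 → R ≤ ρ e) :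
    Real.sqrt (nsq (Y *ᵥ v)) ≤ K * Real.exp (-(κ * (R - c₀))) * Real.sqrt (nsq v) := by
  set w := Y *ᵥ v with hw
  have hK0 : 0 ≤ K := (norm_nonneg _).trans hK
  have hwsupp : ∀ e, w e ≠ 0 → ρ e ≤ c₀ := fun e he => rho_le_of_mulVec_ne_zero hY v e he
  have hK' : ‖conjMat κ (fun e => -ρ e - -R) (fun e => -ρ e - -R) Y‖ ≤ K := by rw [conjMat_sub_const]; exact hK
  have hp := pairing_le_of_opNorm_conjMat hκ hK' (u := w) (v := v) (R := R - c₀)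
    (fun e he => by have := hwsupp e he; linarith) (fun e he => by have := hv e he; linarith)
  have hsq : ‖star w ⬝ᵥ (Y *ᵥ v)‖ = Real.sqrt (nsq w) * Real.sqrt (nsq w) := by
    rw [← hw, star_dotProduct_self, Complex.norm_real, Real.norm_of_nonneg (nsq_nonneg w), Real.mul_self_sqrt (nsq_nonneg w)]
  rw [hsq] at hp
  rcases (Real.sqrt_nonneg (nsq w)).eq_or_lt with h0 | hpos
  · rw [← h0]; positivity
  · refine le_of_mul_le_mul_right ?_ hpos
    calc Real.sqrt (nsq w) * Real.sqrt (nsq w)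
        ≤ K * Real.exp (-(κ * (R - c₀))) * (Real.sqrt (nsq w) * Real.sqrt (nsq v)) := hp
      _ = K * Real.exp (-(κ * (R - c₀))) * Real.sqrt (nsq v) * Real.sqrt (nsq w) := by ring

/-- **`twoPoint_pairing_le` — THE TWO-WEIGHT PAIRING BOUND** (`κ ≥ 0`): `‖conjMat κ ρ ρ G‖ ≤ K_G`, `‖conjMat κ (−ρ) (−ρ) Y‖ ≤ K_Y`, the rows of `Y` live where `ρ ≤ c₀`, `u` is supported
where `ρ ≥ R_u` and `v` where `ρ ≥ R_v` ⟹ `|⟨u, (GY)v⟩| ≤ K_G·K_Y·e^{−κ(R_u − c₀)}·e^{−κ(R_v − c₀)}·√nsq u·√nsq v` — `(GY)v = G(Yv)` with `Yv` near: the left pairing by the weight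
`ρ − c₀`, the right factor by `sqrt_nsq_mulVec_le_of_rows`. [folklore] -/
theorem twoPoint_pairing_le {G Y : Matrix ι ι ℂ} {κ : ℝ} (hκ : 0 ≤ κ) {ρ : ι → ℝ} {KG KY Ru Rv c₀ : ℝ}
    (hG : ‖conjMat κ ρ ρ G‖ ≤ KG) (hYK : ‖conjMat κ (fun e => -ρ e) (fun e => -ρ e) Y‖ ≤ KY) (hY : ∀ e e', Y e e' ≠ 0 → ρ e ≤ c₀)
    {u v : ι → ℂ} (hu : ∀ e, u e ≠ 0 → Ru ≤ ρ e) (hv : ∀ e, v e ≠ 0 → Rv ≤ ρ e) :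
    ‖star u ⬝ᵥ ((G * Y) *ᵥ v)‖
      ≤ KG * KY * Real.exp (-(κ * (Ru - c₀))) * Real.exp (-(κ * (Rv - c₀))) * (Real.sqrt (nsq u) * Real.sqrt (nsq v)) := by
  set w := Y *ᵥ v with hw
  have hKG0 : 0 ≤ KG := (norm_nonneg _).trans hG
  have hwsupp : ∀ e, w e ≠ 0 → ρ e ≤ c₀ := fun e he => rho_le_of_mulVec_ne_zero hY v e he
  have hG' : ‖conjMat κ (fun e => ρ e - c₀) (fun e => ρ e - c₀) G‖ ≤ KG := by rw [conjMat_sub_const]; exact hG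
  have h1 := pairing_le_of_opNorm_conjMat hκ hG' (u := u) (v := w) (R := Ru - c₀)
    (fun e he => by have := hu e he; linarith) (fun e he => by have := hwsupp e he; linarith)
  have h2 := sqrt_nsq_mulVec_le_of_rows hκ hYK hY hv
  rw [← Matrix.mulVec_mulVec]
  calc ‖star u ⬝ᵥ (G *ᵥ w)‖
      ≤ KG * Real.exp (-(κ * (Ru - c₀))) * (Real.sqrt (nsq u) * Real.sqrt (nsq w)) := h1
    _ ≤ KG * Real.exp (-(κ * (Ru - c₀))) * (Real.sqrt (nsq u) * (KY * Real.exp (-(κ * (Rv - c₀))) * Real.sqrt (nsq v))) := by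
        have h0 : 0 ≤ KG * Real.exp (-(κ * (Ru - c₀))) := by positivity
        exact mul_le_mul_of_nonneg_left (mul_le_mul_of_nonneg_left h2 (Real.sqrt_nonneg _)) h0
    _ = KG * KY * Real.exp (-(κ * (Ru - c₀))) * Real.exp (-(κ * (Rv - c₀))) * (Real.sqrt (nsq u) * Real.sqrt (nsq v)) := by ring

variable {τ : ℕ → Type*} [∀ k, Fintype (τ k)] [∀ k, DecidableEq (τ k)]

/-- **`twoPoint_avgTow_le` — TWO-POINT DECAY OF AN AVERAGED KERNEL ABOUT A CENTRE** [our proof] (any averagings `‖A_j‖² ≤ r⁻¹`, `r > 0`; any «distance» `dist` on the unit index;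
`κ ≥ 0`).  Let `X_k = G·Y`, let `ρ` be a weight with `‖conjMat κ ρ ρ G‖ ≤ K_G`, `‖conjMat κ (−ρ) (−ρ) Y‖ ≤ K_Y`, the rows of `Y` living where `ρ ≤ c₀`, and `ρ ≥ dist(x,i) − c` on the
support of the block test vector `Atow_k x` for every `x`.  Then `‖(avgTow A r X k)(x,y)‖ ≤ K_G·K_Y·e^{2κ(c + c₀)}·e^{−κ(dist(x,i) + dist(y,i))}` for all `x, y` — PART 126's
`entryDecay_avgTow_of_support` with ONE centre for BOTH entries. -/
theorem twoPoint_avgTow_le {A : (k : ℕ) → Matrix (τ k) (τ (k + 1)) ℂ} {r : ℝ} (hr : 0 < r) (hA : ∀ k, ‖A k‖ ^ 2 ≤ r⁻¹)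
    {X : (k : ℕ) → Matrix (τ k) (τ k) ℂ} {k : ℕ} {G Y : Matrix (τ k) (τ k) ℂ} (hX : X k = G * Y) {κ KG KY c c₀ : ℝ} (hκ : 0 ≤ κ)
    {dist : τ 0 → τ 0 → ℝ} {i : τ 0} (ρ : τ k → ℝ)
    (hG : ‖conjMat κ ρ ρ G‖ ≤ KG) (hYK : ‖conjMat κ (fun e => -ρ e) (fun e => -ρ e) Y‖ ≤ KY) (hY : ∀ e e', Y e e' ≠ 0 → ρ e ≤ c₀)
    (hR : ∀ x u, Atow A k x u ≠ 0 → dist x i - c ≤ ρ u) (x y : τ 0) :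
    ‖avgTow A r X k x y‖ ≤ KG * KY * Real.exp (κ * (2 * (c + c₀))) * Real.exp (-(κ * (dist x i + dist y i))) := by
  rw [avgTow_apply_eq_pairing, norm_mul, norm_pow, Complex.norm_real, Real.norm_of_nonneg hr.le, hX]
  have hKG0 : 0 ≤ KG := (norm_nonneg _).trans hG
  have hKY0 : 0 ≤ KY := (norm_nonneg _).trans hYK
  have hne : ∀ (z : τ 0) (u : τ k), star (Atow A k z) u ≠ 0 → Atow A k z u ≠ 0 := fun z u hu => by
    rw [Pi.star_apply] at hu
    exact fun h0 => hu (by rw [h0, star_zero])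
  have hp := twoPoint_pairing_le hκ hG hYK hY (u := star (Atow A k x)) (v := star (Atow A k y)) (Ru := dist x i - c) (Rv := dist y i - c)
    (fun u hu => hR x u (hne x u hu)) (fun u hu => hR y u (hne y u hu))
  have hrk : 0 < r ^ k := pow_pos hr k
  have hn : ∀ z : τ 0, Real.sqrt (nsq (star (Atow A k z))) ≤ Real.sqrt ((r ^ k)⁻¹) :=
    fun z => Real.sqrt_le_sqrt (nsq_star_Atow_le A hr hA k z)
  have hss : Real.sqrt ((r ^ k)⁻¹) * Real.sqrt ((r ^ k)⁻¹) = (r ^ k)⁻¹ := Real.mul_self_sqrt (inv_nonneg.mpr hrk.le)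
  have he : Real.exp (-(κ * (dist x i - c - c₀))) * Real.exp (-(κ * (dist y i - c - c₀)))
      = Real.exp (κ * (2 * (c + c₀))) * Real.exp (-(κ * (dist x i + dist y i))) := by
    rw [← Real.exp_add, ← Real.exp_add]
    congr 1
    ring
  calc r ^ k * ‖star (star (Atow A k x)) ⬝ᵥ ((G * Y) *ᵥ star (Atow A k y))‖
      ≤ r ^ k * (KG * KY * Real.exp (-(κ * (dist x i - c - c₀))) * Real.exp (-(κ * (dist y i - c - c₀)))
          * (Real.sqrt ((r ^ k)⁻¹) * Real.sqrt ((r ^ k)⁻¹))) := by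
        refine mul_le_mul_of_nonneg_left (hp.trans ?_) hrk.le
        exact mul_le_mul_of_nonneg_left (mul_le_mul (hn x) (hn y) (Real.sqrt_nonneg _) (Real.sqrt_nonneg _)) (by positivity)
    _ = KG * KY * (Real.exp (-(κ * (dist x i - c - c₀))) * Real.exp (-(κ * (dist y i - c - c₀)))) * (r ^ k * (r ^ k)⁻¹) := by
        rw [hss]; ring
    _ = KG * KY * Real.exp (κ * (2 * (c + c₀))) * Real.exp (-(κ * (dist x i + dist y i))) := by
        rw [he, mul_inv_cancel₀ hrk.ne', mul_one]; ring

end Generic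

/-! ## §2 Bałaban's tower: the weight `−ρ_{k,i}` and the row support of `P(V)·G` -/

section Tower

variable {d : ℕ} (L : ℕ) [NeZero L] (M : Fin d → ℕ) [hM : ∀ μ, NeZero (M μ)] (a : ℝ) (ha : 0 < a)

/-- **NE2's `hJ` AT THE NEGATED CANONICAL WEIGHT**: `ConjDefect (Δ_a^{(k)}) κ (−ρ_{k,y}) (max (JA d a a′ κ 1) 0)` — `CTVectorPropagator.conjDefect_DeltaA` sees only `|ρ(x + e_ν) − ρ(x)| ≤ 1∕n_k`
and the block oscillation `≤ 1`, both invariant under `ρ ↦ −ρ` (`conjDefect_calDalev_rho` verbatim otherwise). [folklore] -/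
theorem conjDefect_calDalev_negRho {a' κ : ℝ} (ha' : 0 < a') (hγ' : CTScalarGreen.Jfree d a' κ 1 < ScalarAveragedPropagator.gammaPs d a')
    (hδ' : CTGaugeTerm.deltaK d a' κ 1 < ScalarAveragedCompression.sigma0 d a' ^ 2) (k : ℕ) (y : idx L M 0) :
    ConjDefect (calDalev L M a ha k) κ (fun u => -rho L M k y u) (max (JA d a a' κ 1) 0) := by
  have h := conjDefect_DeltaA (lev L k) M (a := a) (ρ₀ := fun x => -rhoSite L M k y x) ha' zero_le_one
    (fun x ν => by rw [neg_sub_neg, abs_sub_comm]; exact abs_rhoSite_fineStep_le L M k y x ν)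
    (fun x x' hx => by rw [neg_sub_neg, abs_sub_comm]; exact abs_rhoSite_sub_le_one_of_blockOf_eq L M k y x x' hx) hγ' hδ'
  rw [calDalev, calDa_eq_DeltaA]
  exact h.mono (le_max_left _ _)

/-- **NE2's CONJUGATED (H-bd) AT THE NEGATED CANONICAL WEIGHT**: for coefficient fields of size `≤ α` (no smoothness) and a conjugation-defect bound `J ∈ [0, γ_D[` of `Δ_a^{(k)}` at `−ρ_{k,y}`,
`‖conjMat κ (−ρ) (−ρ) P(V)_k · conjMat κ (−ρ) (−ρ) (Δ_a^{(k)})⁻¹‖ ≤ d·α·G2 d a J (γ_D − J) κ` — `CTConjugatedHbd.opNorm_conjMat_firstOrder_le` (PART 124's `hPc_firstOrder` at `−ρ`). [folklore] -/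
theorem opNorm_conjMat_firstOrder_negRho_le {V : (k : ℕ) → Fin d → (idx L M k → ℂ)} {α : ℝ} (hα : 0 ≤ α) (hVb : ∀ k μ u, ‖V k μ u‖ ≤ α)
    {κ J : ℝ} (hJ0 : 0 ≤ J) (hJγ : J < gamD d a) (k : ℕ) (y : idx L M 0) (hJ : ConjDefect (calDalev L M a ha k) κ (fun u => -rho L M k y u) J) :
    ‖conjMat κ (fun u => -rho L M k y u) (fun u => -rho L M k y u) (Pmodel L M V k)
        * conjMat κ (fun u => -rho L M k y u) (fun u => -rho L M k y u) (calDalev L M a ha k)⁻¹‖ ≤ d * (α * G2 d a J (gamD d a - J) κ) :=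
  opNorm_conjMat_firstOrder_le (lev L k) (one_le_lev' L k) M a ha hJ hJ0 hJγ
    (fun x μ ν => by rw [neg_sub_neg, abs_sub_comm]; exact abs_rho_fineStep_le L M k y x μ ν) hα (hVb k)

omit hM in
/-- **the rows of `P(V)_k·G` live on the support of `V^{(k)}`** (PART 151's stencil `(P(V)G)(e,·) = Σ_μ V_μ(e)·n_k·(G(e + e_μ,·) − G(e,·))`): if a weight `ρ` is `≤ c₀` wherever some
`V^{(k)}_μ ≠ 0`, then `(P(V)_kG)(e,e′) ≠ 0 ⟹ ρ e ≤ c₀`. [folklore] -/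
theorem rho_le_of_Pmodel_mul_ne_zero [∀ μ, NeZero (M μ)] {V : (k : ℕ) → Fin d → (idx L M k → ℂ)} {k : ℕ} {ρ : idx L M k → ℝ} {c₀ : ℝ}
    (hloc : ∀ μ u, V k μ u ≠ 0 → ρ u ≤ c₀) (G : Matrix (idx L M k) (idx L M k) ℂ) (e e' : idx L M k) (h : (Pmodel L M V k * G) e e' ≠ 0) :
    ρ e ≤ c₀ := by
  by_contra hc
  refine h ?_
  rw [Pmodel_mul_apply]
  exact Finset.sum_eq_zero fun μ _ => by rw [show V k μ e = 0 from not_not.mp fun hne => hc (hloc μ e hne), zero_mul]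

end Tower

/-! ## §3 (L-UD): two-point decay of the single-insertion word for every bounded localised background, every torus -/

section TwoPoint

variable {d : ℕ} (L : ℕ) [NeZero L] (a : ℝ) (ha : 0 < a)

/-- **`exists_twoPoint_insertion` — (L-UD): THE SINGLE-INSERTION WORD `X_{i,k} = L^{dk}Q_k(𝒢P(V)𝒢)Q_kᴴ` DECAYS IN BOTH ENTRIES ABOUT THE INSERTION BOND, VOLUME-FREE AND LEVEL-FREE,
FOR EVERY BOUNDED LOCALISED BACKGROUND** [our proof] (`α ≥ 0`, `c₀` arbitrary): `∃ κ > 0, B ≥ 0` depending on `(d, a, α, c₀)` only such that for EVERY torus `M`, EVERY unit bond `i`,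
EVERY coefficient family with `‖V^{(k)}_μ(u)‖ ≤ α` and `V^{(k)}_μ(u) ≠ 0 ⟹ ρ_{k,i}(u) ≤ c₀` (all levels), and all `k, x, y`:
`‖X_{i,k}(x,y)‖ ≤ B·e^{−κ(distK(x,i) + distK(y,i))}`.  `κ` = PART 124's admissible rate; `B = (γ_D − J)⁻¹·dαG₂·e^{2κ(3 + c₀)}`.  NO smoothness of `V` is used. -/
theorem exists_twoPoint_insertion (α c₀ : ℝ) (hα : 0 ≤ α) :
    ∃ κ B : ℝ, 0 < κ ∧ 0 ≤ B ∧ ∀ (M : Fin d → ℕ) [∀ μ, NeZero (M μ)] (i : idx L M 0) (V : (k : ℕ) → Fin d → (idx L M k → ℂ)),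
      (∀ k μ u, ‖V k μ u‖ ≤ α) → (∀ k μ u, V k μ u ≠ 0 → rho L M k i u ≤ c₀) →
      ∀ k x y, ‖avgTow (QBlev L M) ((L : ℝ) ^ d) (fun k => calGlev L M a ha k * Pmodel L M V k * calGlev L M a ha k) k x y‖
        ≤ B * Real.exp (-(κ * (distK L M x i + distK L M y i))) := by
  obtain ⟨κ, hκ0, -, hγ', hδ', hJA⟩ := exists_admissible_rate d a
  have hJγ : max (JA d a 1 κ 1) 0 < gamD d a := max_JA_lt_gamD a hJA
  have hγw : 0 < gamD d a - max (JA d a 1 κ 1) 0 := sub_pos.mpr hJγ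
  have hG2 := G2_nonneg (d := d) a (max (JA d a 1 κ 1) 0) hγw κ
  refine ⟨κ, (gamD d a - max (JA d a 1 κ 1) 0)⁻¹ * (d * (α * G2 d a (max (JA d a 1 κ 1) 0) (gamD d a - max (JA d a 1 κ 1) 0) κ))
      * Real.exp (κ * (2 * (3 + c₀))), hκ0, by positivity, fun M _ i V hVb hloc k x y => ?_⟩
  have hLd : (0 : ℝ) < (L : ℝ) ^ d := pow_pos (by exact_mod_cast Nat.pos_of_ne_zero (NeZero.ne L)) d
  have hW : WCoercive (calDalev L M a ha k) κ (rho L M k i) (gamD d a - max (JA d a 1 κ 1) 0) :=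
    wCoercive_calDa_of_conjDefect (lev L k) (one_le_lev' L k) M a ha (conjDefect_calDalev_rho L M a ha one_pos hγ' hδ' k i)
  have hG : ‖conjMat κ (rho L M k i) (rho L M k i) (calGlev L M a ha k)‖ ≤ (gamD d a - max (JA d a 1 κ 1) 0)⁻¹ := by
    rw [← calDalev_inv]; exact opNorm_conjMat_inv_le_of_wCoercive hW hγw
  have hYK : ‖conjMat κ (fun u => -rho L M k i u) (fun u => -rho L M k i u) (Pmodel L M V k * calGlev L M a ha k)‖
      ≤ d * (α * G2 d a (max (JA d a 1 κ 1) 0) (gamD d a - max (JA d a 1 κ 1) 0) κ) := by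
    rw [conjMat_mul_same, ← calDalev_inv]
    exact opNorm_conjMat_firstOrder_negRho_le L M a ha hα hVb (le_max_right _ _) hJγ k i (conjDefect_calDalev_negRho L M a ha one_pos hγ' hδ' k i)
  have hY : ∀ e e', (Pmodel L M V k * calGlev L M a ha k) e e' ≠ 0 → rho L M k i e ≤ c₀ :=
    fun e e' h => rho_le_of_Pmodel_mul_ne_zero L M (fun μ u hu => hloc k μ u hu) _ e e' h
  exact twoPoint_avgTow_le hLd (opNorm_QBlev_sq_le L M) (X := fun k => calGlev L M a ha k * Pmodel L M V k * calGlev L M a ha k)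
    (Matrix.mul_assoc _ _ _) hκ0.le (dist := distK L M) (i := i) (c := 3) (rho L M k i) hG hYK hY
    (fun x u hu => distK_sub_three_le_rho_of_near L M k x i u (tdist_blockOf_le_one_of_Atow_QBlev_ne_zero L M k x u hu)) x y

/-! ## §4 (L-UD)+(L-SR): the level and step envelopes of the single-insertion word of a localised Lipschitz background, every torus -/

/-- **`exists_twoPoint_insertion_rate` — (L-UD)+(L-SR): THE TWO LEG ENVELOPES OF THE SINGLE-INSERTION WORD OF A LOCALISED LIPSCHITZ BACKGROUND, VOLUME-FREE** [our proof]
(`L ≥ 2`, `d ≥ 1`): `∃ κ > 0, B, B′ ≥ 0` depending on `(d, L, a, α, β, c₀)` only such that for EVERY torus `M`, EVERY unit bond `i`, EVERY `LipschitzBackground V α β` with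
`V^{(k)}_μ(u) ≠ 0 ⟹ ρ_{k,i}(u) ≤ c₀`, and all `k, x, y`: `‖X_{i,k}(x,y)‖ ≤ B·e^{−κ(distK(x,i) + distK(y,i))}` and `‖(X_{i,k+1} − X_{i,k})(x,y)‖ ≤ B′·(√(L⁻¹))^k·e^{−κ(distK(x,i) + distK(y,i))}`
— §3's two-point decay at every level interpolated with PART 122's operator-norm tower rate `L^{−k}` (`towerLimitRate_word` on NE2's `freeTowerLaws_balaban` ∕ `perturbationLaws_firstOrder`)
by `decayRate_of_towerLimitRate` in the two-point «distance» `(x,y) ↦ distK(x,i) + distK(y,i)`.  Exactly the shapes `hΓ`, `hΓ′` of PART 197. -/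
theorem exists_twoPoint_insertion_rate (hL : 2 ≤ L) (hd : 1 ≤ d) (α β c₀ : ℝ) :
    ∃ κ B B' : ℝ, 0 < κ ∧ 0 ≤ B ∧ 0 ≤ B' ∧ ∀ (M : Fin d → ℕ) [∀ μ, NeZero (M μ)] (i : idx L M 0) (V : (k : ℕ) → Fin d → (idx L M k → ℂ)),
      LipschitzBackground L M V α β → (∀ k μ u, V k μ u ≠ 0 → rho L M k i u ≤ c₀) →
      (∀ k x y, ‖avgTow (QBlev L M) ((L : ℝ) ^ d) (fun k => calGlev L M a ha k * Pmodel L M V k * calGlev L M a ha k) k x y‖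
        ≤ B * Real.exp (-(κ * (distK L M x i + distK L M y i)))) ∧
      (∀ k x y, ‖(avgTow (QBlev L M) ((L : ℝ) ^ d) (fun k => calGlev L M a ha k * Pmodel L M V k * calGlev L M a ha k) (k + 1)
          - avgTow (QBlev L M) ((L : ℝ) ^ d) (fun k => calGlev L M a ha k * Pmodel L M V k * calGlev L M a ha k) k) x y‖
        ≤ B' * Real.sqrt ((L : ℝ)⁻¹) ^ k * Real.exp (-(κ * (distK L M x i + distK L M y i)))) := by
  by_cases hαβ : 0 ≤ α ∧ 0 ≤ β
  swap
  · exact ⟨1, 0, 0, one_pos, le_rfl, le_rfl, fun M _ i V hV _ => absurd hV.nonneg hαβ⟩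
  obtain ⟨hα, hβ⟩ := hαβ
  obtain ⟨κ, B, hκ0, hB, hUD⟩ := exists_twoPoint_insertion L a ha α c₀ hα
  set κ₀ : ℝ := d * (α + β) * Cst d a with hκ₀
  set w : List Unit := [()] with hwdef
  set C : ℝ := ((w.length + 1) * κ₀ ^ w.length * CJ d a + w.length * κ₀ ^ (w.length - 1) * C2model d L a α β)
    + κ₀ ^ w.length * (2 * d * Cst d a + 2 * (d * L * Cst d a)) with hCdef
  have hL1 : (1 : ℝ) < L := by exact_mod_cast (lt_of_lt_of_le one_lt_two hL : 1 < L)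
  have hρ0 : (0 : ℝ) ≤ (L : ℝ)⁻¹ := inv_nonneg.mpr (Nat.cast_nonneg _)
  have hρ1 : ((L : ℝ)⁻¹) < 1 := inv_lt_one_of_one_lt₀ hL1
  have hr : (0 : ℝ) < (L : ℝ) ^ d := pow_pos (lt_trans zero_lt_one hL1) d
  have hCst := Cst_nonneg d a
  have hCJ := CJ_nonneg d a
  have hκ₀0 : 0 ≤ κ₀ := by positivity
  have hC2 : 0 ≤ C2model d L a α β := by unfold C2model; positivity
  have hC0 : 0 ≤ C := by positivity
  refine ⟨κ / 2, B, Real.sqrt (2 * B * (2 * C / (1 - (L : ℝ)⁻¹))), half_pos hκ0, hB, Real.sqrt_nonneg _, fun M _ i V hV hloc => ?_⟩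
  -- the operator-norm tower rate of the word `[i]` (PART 122 on Bałaban's tower)
  have hT := towerLimitRate_word hr (freeTowerLaws_balaban L M a ha) (fun _ : Unit => perturbationLaws_firstOrder L M a ha hd hV) hκ₀0
    (fun k => mul_nonneg hC2 (pow_nonneg hρ0 k)) hρ1 (fun k => le_rfl) (fun k => le_rfl) (fun k => le_rfl) (fun k => le_rfl) w
  have e : (fun k => List.foldr (fun (_ : Unit) N => (calDalev L M a ha k)⁻¹ * Pmodel L M V k * N) (calDalev L M a ha k)⁻¹ w)
      = fun k => calGlev L M a ha k * Pmodel L M V k * calGlev L M a ha k := by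
    funext k; rw [hwdef, List.foldr_cons, List.foldr_nil, calDalev_inv]
  rw [e] at hT
  -- §3 at every level, as `EntryDecay` in the two-point «distance»
  have hdec : ∀ k, EntryDecay (fun x y => distK L M x i + distK L M y i)
      (avgTow (QBlev L M) ((L : ℝ) ^ d) (fun k => calGlev L M a ha k * Pmodel L M V k * calGlev L M a ha k) k) B κ :=
    fun k x y => hUD M i V hV.bound hloc k x y
  obtain ⟨clim, -, -, -, hstep⟩ := decayRate_of_towerLimitRate hρ0 hρ1 hC0 hT hdec
  refine ⟨fun k x y => (hUD M i V hV.bound hloc k x y).trans (mul_le_mul_of_nonneg_left (Real.exp_le_exp.mpr ?_) hB), fun k x y => hstep k x y⟩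
  have h0 : 0 ≤ distK L M x i + distK L M y i := add_nonneg (distK_nonneg L M _ _) (distK_nonneg L M _ _)
  nlinarith

end TwoPoint

end Summit.QuantumFields.BalabanUV.Beta.GAN24.InsertionWordTwoPointDecay

end
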